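import Summits.ResolutionOfSingularities.ResolutionOfSingularities.Theorems.CossartPiltant2019PatchingHolds
import Literature.AlgebraicGeometry.Resolution.ArithmeticalThreefoldsLocalDescentEquivariantSplit
import Literature.AlgebraicGeometry.Resolution.ArithmeticalThreefoldsLocalDescentEmbChain6
import Literature.AlgebraicGeometry.Resolution.ResolutionSurfacesOfEmbeddedProjective
import Literature.AlgebraicGeometry.Resolution.ProjectiveSpaceCodimTwoReembedding
import Literature.AlgebraicGeometry.Resolution.ArithmeticalThreefoldsDescentHead
import Literature.AlgebraicGeometry.Resolution.LUCompleteChar0TrustBase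
import HarnessLib

/-!
# `CleanModels`, stub 2 (`stub_cossartPiltant2019` = F-02 `CossartPiltant2019`): the exact leaf list, in kernel

OURS (decomp-res hand-1 g16; crux `stmt-ResolutionOfSingularities-15917`, skeleton rev 35 `Cruxes/CleanModels/Lines/Sketch.lean`,
stub `stub_cossartPiltant2019 : CossartPiltant2019.{0}`). A BOOKKEEPING file: it composes landed tree theorems and proves nothing new
about resolution of singularities; its point is that the remaining inputs of F-02 along Cossart–Piltant's own architecture are now
visible in ONE kernel-checked signature, with the two inputs that the tree has PROVED in the meantime — principalization
(`CP2008Prop44.CossartPiltant2019Principalization_holds`, from [CoP1] Prop. 4.4 `cossartPiltant2008_prop44_holds`) and the enhanced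
Zariski patching (`CP2008Prop44.CossartPiltant2019Patching_holds`) — DISCHARGED rather than carried as hypotheses.

* `cossartPiltant2019_of_reductionP` — `CossartPiltant2019Local → CossartPiltant2019ReductionP → Hironaka1964_local →
  CossartPiltant2019_descentHead → CossartJannsenSaito2020 → CossartPiltant2019` (patching discharged).
* `cossartPiltant2019_of_leaves` — the same with `CossartPiltant2019ReductionP` replaced by ITS inputs as landed by hand-1 g15
  (`cossartPiltant2019ReductionP_of_printed_of_equivariantLU_split`): the local theorem (CP 2019 Thm. 1.5), Cossart–Jannsen–Saito
  Thm. 1.2 (`CossartJannsenSaito2020General`) and Thm. 1.4 with `B = ∅` (`CossartJannsenSaito2020Embedded` — the TYPE of the crux's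
  stub 1 `stub_cjs2020Thm14` at universe `0`), and the two equivariant local-uniformization statements `hEqT` (Kummer type) and
  `hEqI` (inertia type) that are NOT in print (principalization discharged).

So, by name, F-02 at universe `0` ⟸ { `CossartPiltant2019Local`, `CossartJannsenSaito2020General`, `CossartJannsenSaito2020Embedded`
(= stub 1), `Hironaka1964_local`, `CossartPiltant2019_descentHead`, `CossartJannsenSaito2020` } ∪ { `hEqT`, `hEqI` }.
Nothing here proves resolution of singularities in positive characteristic, local uniformization, or any statement of a manuscript
under adjudication. AI-written; AI review weaker than expert review.
-/

-- `Summit.<Summit>.<Sub>.Theorems` with `Sub = Summit` (single-conjunct summit, D-0017)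
set_option linter.dupNamespace false

noncomputable section

open IsLocalRing Polynomial
open Literature.AlgebraicGeometry.Resolution
open Summit.ResolutionOfSingularities.ResolutionOfSingularities.Theorems.CP2008Prop44

namespace Summit.ResolutionOfSingularities.ResolutionOfSingularities.Theorems.RadicialJung.CleanModels

universe u

/-- **F-02 from the local theorem, the reduction `CossartPiltant2019ReductionP`, Hironaka's theorem over local quasi-excellent rings
of residue characteristic zero, the geometric head of CP 2019 Prop. 4.8 and Cossart–Jannsen–Saito Thm. 1.2 over fields** — the tree's
assembly `cossartPiltant2019_of_local` with its residue-characteristic-zero leaf fed by `CossartPiltant2019LUCompleteChar0_holds_of`,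
its Prop. 4.8 leaf by `CossartPiltant2019LU3OfComplete_holds_of`, and the patching leaf DISCHARGED by the tree theorem
`CossartPiltant2019Patching_holds`. [cite: CossartPiltant2019, Thm. 1.1, Ch. 4 (Props. 4.6, 4.8, 4.10)] -/
theorem cossartPiltant2019_of_reductionP (hloc : CossartPiltant2019Local.{u})
    (hred : CossartPiltant2019ReductionP.{u}) (hH : Hironaka1964_local.{u})
    (hhead : CossartPiltant2019_descentHead.{u}) (hCJS : CossartJannsenSaito2020.{u}) :
    CossartPiltant2019.{u} :=
  cossartPiltant2019_of_local hloc hred (CossartPiltant2019LUCompleteChar0_holds_of hH)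
    (CossartPiltant2019LU3OfComplete_holds_of hCJS hhead) hCJS CossartPiltant2019Patching_holds

/-- **The leaf list of F-02 (`CossartPiltant2019`, the type of the crux stub `stub_cossartPiltant2019` at universe `0`) along
Cossart–Piltant's architecture, as of 2026-08-31**: the local theorem `CossartPiltant2019Local` (CP 2019 Thm. 1.5),
Cossart–Jannsen–Saito Thm. 1.2 for excellent surfaces (`CossartJannsenSaito2020General`) and Thm. 1.4 with `B = ∅`
(`CossartJannsenSaito2020Embedded`, the type of stub 1 `stub_cjs2020Thm14`), the two NON-PRINTED equivariant local uniformizations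
`hEqT` (a group of `S`-automorphisms of prime exponent `ℓ ≠ p` acting on the subfield `M′`, residually trivially on `O_E ∩ M′`, every
non-trivial element moving some `x ∈ M′` by exactly `v(x)` — [CoP1] Lemma 9.4 «`S` is stable by `G`») and `hEqI` (a group each of whose
non-trivial elements moves a unit of `O_E ∩ M′` by a unit, with one-element cofinality — CP 2019 p. 54, inertia layer of Prop. 9.3),
VERBATIM the hypotheses of `cossartPiltant2019ReductionP_of_printed_of_equivariantLU_split`, Hironaka 1964 over local quasi-excellent
rings of residue characteristic zero (`Hironaka1964_local`, Temkin 2008 Thm. 2.3.6), the geometric head of Prop. 4.8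
(`CossartPiltant2019_descentHead`) and CJS Thm. 1.2 over fields (`CossartJannsenSaito2020`) imply `CossartPiltant2019`;
principalization (Prop. 4.4) and patching (Prop. 4.6) are discharged by the tree theorems
`CossartPiltant2019Principalization_holds` / `CossartPiltant2019Patching_holds`.
[cite: CossartPiltant2019, Thm. 1.1, Thm. 1.5, Props. 4.4, 4.6, 4.8, 4.10] [cite: CossartPiltant2008, Prop. 9.3, Lemma 9.4]
[cite: CossartJannsenSaito2020, Thm. 1.2, Thm. 1.4] [cite: Temkin2008, Thm. 2.3.6] -/
theorem cossartPiltant2019_of_leaves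
    (hloc : CossartPiltant2019Local.{u})
    (hCJS : CossartJannsenSaito2020General.{u}) (hCJSE : CossartJannsenSaito2020Embedded.{u})
    (hEqT :
      ∀ (p : ℕ), p.Prime →
      ∀ (S : Type u) [CommRing S] [IsDomain S] [IsRegularLocalRing S],
        IsExcellentRing S → ringKrullDim S = 3 → CharP (ResidueField S) p →
        IsAdicComplete (maximalIdeal S) S →
      ∀ (E : Type u) [Field E] [Algebra S E], Function.Injective (algebraMap S E) →
        IsAlgClosed E → Algebra.IsAlgebraic S E →
      ∀ (OE : ValuationSubring E), (∀ s : S, algebraMap S E s ∈ OE) →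
        (∀ s ∈ maximalIdeal S, OE.valuation (algebraMap S E s) < 1) →
        (∀ y : OE, ∃ q : S[X], (∃ i, q.coeff i ∉ maximalIdeal S) ∧
          OE.valuation (q.eval₂ (algebraMap S E) y) < 1) →
      Nonempty OE.valuation.RankOne →
      ∀ (M' : Subfield E), (∀ s : S, algebraMap S E s ∈ M') →
      ∀ (H : Subgroup (E ≃ₐ[S] E)),
        (∀ σ ∈ H, ∀ x ∈ M', σ x ∈ M') →
        (∀ σ ∈ H, ∀ x ∈ M', x ∈ OE → σ x ∈ OE) →
        (∀ σ ∈ H, ∀ x ∈ M', x ∈ OE → OE.valuation (σ x - x) < 1) →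
        (∃ ℓ : ℕ, ℓ.Prime ∧ ℓ ≠ p ∧ ∀ σ ∈ H, ∀ x ∈ M', (σ ^ ℓ) x = x) →
        (∀ σ ∈ H, (∃ x ∈ M', σ x ≠ x) →
          ∃ x ∈ M', x ≠ 0 ∧ OE.valuation (σ x - x) = OE.valuation x) →
        (∃ t : Finset E, (t : Set E) ⊆ M' ∧
          M' ≤ Subfield.closure (Set.range (algebraMap S E) ∪ (t : Set E)) ∧
          ∃ hTO : (Algebra.adjoin S (t : Set E)).toSubring ≤ OE.toSubring,
            IsRegularLocalRing (Localization.AtPrime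
              (Ideal.comap (Subring.inclusion hTO) (maximalIdeal OE)))) →
        ∃ t : Finset E, (t : Set E) ⊆ M' ∧
          M' ≤ Subfield.closure (Set.range (algebraMap S E) ∪ (t : Set E)) ∧
          ∃ hTO : (Algebra.adjoin S (t : Set E)).toSubring ≤ OE.toSubring,
            IsRegularLocalRing (Localization.AtPrime
              (Ideal.comap (Subring.inclusion hTO) (maximalIdeal OE))) ∧
            (∀ σ ∈ H, ∀ x ∈ locAtCentre (Algebra.adjoin S (t : Set E)).toSubring OE,
              σ x ∈ locAtCentre (Algebra.adjoin S (t : Set E)).toSubring OE))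
    (hEqI :
      ∀ (p : ℕ), p.Prime →
      ∀ (S : Type u) [CommRing S] [IsDomain S] [IsRegularLocalRing S],
        IsExcellentRing S → ringKrullDim S = 3 → CharP (ResidueField S) p →
        IsAdicComplete (maximalIdeal S) S →
      ∀ (E : Type u) [Field E] [Algebra S E], Function.Injective (algebraMap S E) →
        IsAlgClosed E → Algebra.IsAlgebraic S E →
      ∀ (OE : ValuationSubring E), (∀ s : S, algebraMap S E s ∈ OE) →
        (∀ s ∈ maximalIdeal S, OE.valuation (algebraMap S E s) < 1) →
        (∀ y : OE, ∃ q : S[X], (∃ i, q.coeff i ∉ maximalIdeal S) ∧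
          OE.valuation (q.eval₂ (algebraMap S E) y) < 1) →
      Nonempty OE.valuation.RankOne →
      ∀ (M' : Subfield E), (∀ s : S, algebraMap S E s ∈ M') →
      ∀ (H : Subgroup (E ≃ₐ[S] E)),
        (∀ σ ∈ H, ∀ x ∈ M', σ x ∈ M') →
        (∀ σ ∈ H, ∀ x ∈ M', x ∈ OE → σ x ∈ OE) →
        (∀ σ ∈ H, (∃ x ∈ M', σ x ≠ x) →
          ∃ x ∈ M', OE.valuation x = 1 ∧ OE.valuation (σ x - x) = 1) →
      ∀ (x₀ : E), x₀ ∈ M' → x₀ ∈ OE →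
        (∃ t : Finset E, (t : Set E) ⊆ M' ∧
          M' ≤ Subfield.closure (Set.range (algebraMap S E) ∪ (t : Set E)) ∧
          ∃ hTO : (Algebra.adjoin S (t : Set E)).toSubring ≤ OE.toSubring,
            IsRegularLocalRing (Localization.AtPrime
              (Ideal.comap (Subring.inclusion hTO) (maximalIdeal OE)))) →
        ∃ t : Finset E, (t : Set E) ⊆ M' ∧
          M' ≤ Subfield.closure (Set.range (algebraMap S E) ∪ (t : Set E)) ∧
          ∃ hTO : (Algebra.adjoin S (t : Set E)).toSubring ≤ OE.toSubring,
            IsRegularLocalRing (Localization.AtPrime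
              (Ideal.comap (Subring.inclusion hTO) (maximalIdeal OE))) ∧
            (∀ σ ∈ H, ∀ x ∈ locAtCentre (Algebra.adjoin S (t : Set E)).toSubring OE,
              σ x ∈ locAtCentre (Algebra.adjoin S (t : Set E)).toSubring OE) ∧
            x₀ ∈ locAtCentre (Algebra.adjoin S (t : Set E)).toSubring OE)
    (hH : Hironaka1964_local.{u}) (hhead : CossartPiltant2019_descentHead.{u})
    (hCJS2 : CossartJannsenSaito2020.{u}) :
    CossartPiltant2019.{u} :=
  cossartPiltant2019_of_reductionP hloc
    (cossartPiltant2019ReductionP_of_printed_of_equivariantLU_split hloc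
      CossartPiltant2019Principalization_holds hCJS hCJSE hEqT hEqI)
    hH hhead hCJS2

/-- **The leaf list of F-02 WITHOUT the non-embedded Cossart–Jannsen–Saito theorem** (hand-1 g16): as
`cossartPiltant2019_of_leaves`, but the reduction `CossartPiltant2019ReductionP` is taken from the chain RE-KEYED on
CJS Thm. 1.4 with `B = ∅` (`cossartPiltant2019ReductionP_of_embPrinted_of_equivariantLU_split`,
`ArithmeticalThreefoldsLocalDescentEmbChain6.lean`: the rank-one reduction (C5) of Prop. 4.10 is served by
`rankOne_reduction_of_cjsEmbedded`), so that `CossartJannsenSaito2020General` (CJS Thm. 1.2 for arbitrary excellent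
surfaces) is NO LONGER an input.  By name, F-02 at universe `0` ⟸ { `CossartPiltant2019Local` (CP Thm. 1.5),
`CossartJannsenSaito2020Embedded` (= the crux's stub 1), `hEqT`, `hEqI` (not in print), `Hironaka1964_local`
(Temkin 2008 Thm. 2.3.6), `CossartPiltant2019_descentHead`, `CossartJannsenSaito2020` (CJS Thm. 1.2 over FIELDS) };
principalization and patching are discharged by tree theorems.
[cite: CossartPiltant2019, Thm. 1.1, Thm. 1.5, Props. 4.4, 4.6, 4.8, 4.10] [cite: CossartPiltant2008, Prop. 9.3, Lemma 9.4]
[cite: CossartJannsenSaito2020, Thm. 1.2, Thm. 1.4] [cite: Temkin2008, Thm. 2.3.6] -/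
theorem cossartPiltant2019_of_leaves_embedded
    (hloc : CossartPiltant2019Local.{u}) (hCJSE : CossartJannsenSaito2020Embedded.{u})
    (hEqT :
      ∀ (p : ℕ), p.Prime →
      ∀ (S : Type u) [CommRing S] [IsDomain S] [IsRegularLocalRing S],
        IsExcellentRing S → ringKrullDim S = 3 → CharP (ResidueField S) p →
        IsAdicComplete (maximalIdeal S) S →
      ∀ (E : Type u) [Field E] [Algebra S E], Function.Injective (algebraMap S E) →
        IsAlgClosed E → Algebra.IsAlgebraic S E →
      ∀ (OE : ValuationSubring E), (∀ s : S, algebraMap S E s ∈ OE) →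
        (∀ s ∈ maximalIdeal S, OE.valuation (algebraMap S E s) < 1) →
        (∀ y : OE, ∃ q : S[X], (∃ i, q.coeff i ∉ maximalIdeal S) ∧
          OE.valuation (q.eval₂ (algebraMap S E) y) < 1) →
      Nonempty OE.valuation.RankOne →
      ∀ (M' : Subfield E), (∀ s : S, algebraMap S E s ∈ M') →
      ∀ (H : Subgroup (E ≃ₐ[S] E)),
        (∀ σ ∈ H, ∀ x ∈ M', σ x ∈ M') →
        (∀ σ ∈ H, ∀ x ∈ M', x ∈ OE → σ x ∈ OE) →
        (∀ σ ∈ H, ∀ x ∈ M', x ∈ OE → OE.valuation (σ x - x) < 1) →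
        (∃ ℓ : ℕ, ℓ.Prime ∧ ℓ ≠ p ∧ ∀ σ ∈ H, ∀ x ∈ M', (σ ^ ℓ) x = x) →
        (∀ σ ∈ H, (∃ x ∈ M', σ x ≠ x) →
          ∃ x ∈ M', x ≠ 0 ∧ OE.valuation (σ x - x) = OE.valuation x) →
        (∃ t : Finset E, (t : Set E) ⊆ M' ∧
          M' ≤ Subfield.closure (Set.range (algebraMap S E) ∪ (t : Set E)) ∧
          ∃ hTO : (Algebra.adjoin S (t : Set E)).toSubring ≤ OE.toSubring,
            IsRegularLocalRing (Localization.AtPrime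
              (Ideal.comap (Subring.inclusion hTO) (maximalIdeal OE)))) →
        ∃ t : Finset E, (t : Set E) ⊆ M' ∧
          M' ≤ Subfield.closure (Set.range (algebraMap S E) ∪ (t : Set E)) ∧
          ∃ hTO : (Algebra.adjoin S (t : Set E)).toSubring ≤ OE.toSubring,
            IsRegularLocalRing (Localization.AtPrime
              (Ideal.comap (Subring.inclusion hTO) (maximalIdeal OE))) ∧
            (∀ σ ∈ H, ∀ x ∈ locAtCentre (Algebra.adjoin S (t : Set E)).toSubring OE,
              σ x ∈ locAtCentre (Algebra.adjoin S (t : Set E)).toSubring OE))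
    (hEqI :
      ∀ (p : ℕ), p.Prime →
      ∀ (S : Type u) [CommRing S] [IsDomain S] [IsRegularLocalRing S],
        IsExcellentRing S → ringKrullDim S = 3 → CharP (ResidueField S) p →
        IsAdicComplete (maximalIdeal S) S →
      ∀ (E : Type u) [Field E] [Algebra S E], Function.Injective (algebraMap S E) →
        IsAlgClosed E → Algebra.IsAlgebraic S E →
      ∀ (OE : ValuationSubring E), (∀ s : S, algebraMap S E s ∈ OE) →
        (∀ s ∈ maximalIdeal S, OE.valuation (algebraMap S E s) < 1) →
        (∀ y : OE, ∃ q : S[X], (∃ i, q.coeff i ∉ maximalIdeal S) ∧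
          OE.valuation (q.eval₂ (algebraMap S E) y) < 1) →
      Nonempty OE.valuation.RankOne →
      ∀ (M' : Subfield E), (∀ s : S, algebraMap S E s ∈ M') →
      ∀ (H : Subgroup (E ≃ₐ[S] E)),
        (∀ σ ∈ H, ∀ x ∈ M', σ x ∈ M') →
        (∀ σ ∈ H, ∀ x ∈ M', x ∈ OE → σ x ∈ OE) →
        (∀ σ ∈ H, (∃ x ∈ M', σ x ≠ x) →
          ∃ x ∈ M', OE.valuation x = 1 ∧ OE.valuation (σ x - x) = 1) →
      ∀ (x₀ : E), x₀ ∈ M' → x₀ ∈ OE →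
        (∃ t : Finset E, (t : Set E) ⊆ M' ∧
          M' ≤ Subfield.closure (Set.range (algebraMap S E) ∪ (t : Set E)) ∧
          ∃ hTO : (Algebra.adjoin S (t : Set E)).toSubring ≤ OE.toSubring,
            IsRegularLocalRing (Localization.AtPrime
              (Ideal.comap (Subring.inclusion hTO) (maximalIdeal OE)))) →
        ∃ t : Finset E, (t : Set E) ⊆ M' ∧
          M' ≤ Subfield.closure (Set.range (algebraMap S E) ∪ (t : Set E)) ∧
          ∃ hTO : (Algebra.adjoin S (t : Set E)).toSubring ≤ OE.toSubring,
            IsRegularLocalRing (Localization.AtPrime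
              (Ideal.comap (Subring.inclusion hTO) (maximalIdeal OE))) ∧
            (∀ σ ∈ H, ∀ x ∈ locAtCentre (Algebra.adjoin S (t : Set E)).toSubring OE,
              σ x ∈ locAtCentre (Algebra.adjoin S (t : Set E)).toSubring OE) ∧
            x₀ ∈ locAtCentre (Algebra.adjoin S (t : Set E)).toSubring OE)
    (hH : Hironaka1964_local.{u}) (hhead : CossartPiltant2019_descentHead.{u})
    (hCJS2 : CossartJannsenSaito2020.{u}) :
    CossartPiltant2019.{u} :=
  cossartPiltant2019_of_reductionP hloc
    (cossartPiltant2019ReductionP_of_embPrinted_of_equivariantLU_split hloc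
      CossartPiltant2019Principalization_holds hCJSE hEqT hEqI)
    hH hhead hCJS2

/-- **The leaf list of F-02 with EVERY surface-resolution input keyed on stub 1** (hand-1 g16): as
`cossartPiltant2019_of_leaves_embedded`, with the last non-embedded input — CJS Thm. 1.2 over FIELDS
(`CossartJannsenSaito2020`) — replaced by its derivation from CJS Thm. 1.4 with `B = ∅` modulo ONE elementary
geometric input `hP` (`cossartJannsenSaito2020_of_embedded_of_reembedding`): every `ℙⁿ_k` admits a closed immersion
into some Noetherian regular excellent scheme whose local rings at the image points have dimension `≥ 2` (e.g. the
zero section of `𝔸²` over `ℙⁿ_k`, or a linear `ℙⁿ ↪ ℙⁿ⁺²`; not yet in the tree).  By name, F-02 at universe `0` ⟸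
{ `CossartPiltant2019Local` (CP Thm. 1.5), `CossartJannsenSaito2020Embedded` (= stub 1), `hEqT`, `hEqI`,
`Hironaka1964_local` (Temkin 2008), `CossartPiltant2019_descentHead`, `hP` }.
[cite: CossartPiltant2019, Thm. 1.1, Thm. 1.5, Props. 4.4, 4.6, 4.8, 4.10] [cite: CossartPiltant2008, Prop. 9.3, Lemma 9.4]
[cite: CossartJannsenSaito2020, Thm. 1.2, Thm. 1.4] [cite: Temkin2008, Thm. 2.3.6] -/
theorem cossartPiltant2019_of_leaves_embedded_of_reembedding
    (hloc : CossartPiltant2019Local.{u}) (hCJSE : CossartJannsenSaito2020Embedded.{u})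
    (hEqT :
      ∀ (p : ℕ), p.Prime →
      ∀ (S : Type u) [CommRing S] [IsDomain S] [IsRegularLocalRing S],
        IsExcellentRing S → ringKrullDim S = 3 → CharP (ResidueField S) p →
        IsAdicComplete (maximalIdeal S) S →
      ∀ (E : Type u) [Field E] [Algebra S E], Function.Injective (algebraMap S E) →
        IsAlgClosed E → Algebra.IsAlgebraic S E →
      ∀ (OE : ValuationSubring E), (∀ s : S, algebraMap S E s ∈ OE) →
        (∀ s ∈ maximalIdeal S, OE.valuation (algebraMap S E s) < 1) →
        (∀ y : OE, ∃ q : S[X], (∃ i, q.coeff i ∉ maximalIdeal S) ∧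
          OE.valuation (q.eval₂ (algebraMap S E) y) < 1) →
      Nonempty OE.valuation.RankOne →
      ∀ (M' : Subfield E), (∀ s : S, algebraMap S E s ∈ M') →
      ∀ (H : Subgroup (E ≃ₐ[S] E)),
        (∀ σ ∈ H, ∀ x ∈ M', σ x ∈ M') →
        (∀ σ ∈ H, ∀ x ∈ M', x ∈ OE → σ x ∈ OE) →
        (∀ σ ∈ H, ∀ x ∈ M', x ∈ OE → OE.valuation (σ x - x) < 1) →
        (∃ ℓ : ℕ, ℓ.Prime ∧ ℓ ≠ p ∧ ∀ σ ∈ H, ∀ x ∈ M', (σ ^ ℓ) x = x) →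
        (∀ σ ∈ H, (∃ x ∈ M', σ x ≠ x) →
          ∃ x ∈ M', x ≠ 0 ∧ OE.valuation (σ x - x) = OE.valuation x) →
        (∃ t : Finset E, (t : Set E) ⊆ M' ∧
          M' ≤ Subfield.closure (Set.range (algebraMap S E) ∪ (t : Set E)) ∧
          ∃ hTO : (Algebra.adjoin S (t : Set E)).toSubring ≤ OE.toSubring,
            IsRegularLocalRing (Localization.AtPrime
              (Ideal.comap (Subring.inclusion hTO) (maximalIdeal OE)))) →
        ∃ t : Finset E, (t : Set E) ⊆ M' ∧
          M' ≤ Subfield.closure (Set.range (algebraMap S E) ∪ (t : Set E)) ∧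
          ∃ hTO : (Algebra.adjoin S (t : Set E)).toSubring ≤ OE.toSubring,
            IsRegularLocalRing (Localization.AtPrime
              (Ideal.comap (Subring.inclusion hTO) (maximalIdeal OE))) ∧
            (∀ σ ∈ H, ∀ x ∈ locAtCentre (Algebra.adjoin S (t : Set E)).toSubring OE,
              σ x ∈ locAtCentre (Algebra.adjoin S (t : Set E)).toSubring OE))
    (hEqI :
      ∀ (p : ℕ), p.Prime →
      ∀ (S : Type u) [CommRing S] [IsDomain S] [IsRegularLocalRing S],
        IsExcellentRing S → ringKrullDim S = 3 → CharP (ResidueField S) p →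
        IsAdicComplete (maximalIdeal S) S →
      ∀ (E : Type u) [Field E] [Algebra S E], Function.Injective (algebraMap S E) →
        IsAlgClosed E → Algebra.IsAlgebraic S E →
      ∀ (OE : ValuationSubring E), (∀ s : S, algebraMap S E s ∈ OE) →
        (∀ s ∈ maximalIdeal S, OE.valuation (algebraMap S E s) < 1) →
        (∀ y : OE, ∃ q : S[X], (∃ i, q.coeff i ∉ maximalIdeal S) ∧
          OE.valuation (q.eval₂ (algebraMap S E) y) < 1) →
      Nonempty OE.valuation.RankOne →
      ∀ (M' : Subfield E), (∀ s : S, algebraMap S E s ∈ M') →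
      ∀ (H : Subgroup (E ≃ₐ[S] E)),
        (∀ σ ∈ H, ∀ x ∈ M', σ x ∈ M') →
        (∀ σ ∈ H, ∀ x ∈ M', x ∈ OE → σ x ∈ OE) →
        (∀ σ ∈ H, (∃ x ∈ M', σ x ≠ x) →
          ∃ x ∈ M', OE.valuation x = 1 ∧ OE.valuation (σ x - x) = 1) →
      ∀ (x₀ : E), x₀ ∈ M' → x₀ ∈ OE →
        (∃ t : Finset E, (t : Set E) ⊆ M' ∧
          M' ≤ Subfield.closure (Set.range (algebraMap S E) ∪ (t : Set E)) ∧
          ∃ hTO : (Algebra.adjoin S (t : Set E)).toSubring ≤ OE.toSubring,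
            IsRegularLocalRing (Localization.AtPrime
              (Ideal.comap (Subring.inclusion hTO) (maximalIdeal OE)))) →
        ∃ t : Finset E, (t : Set E) ⊆ M' ∧
          M' ≤ Subfield.closure (Set.range (algebraMap S E) ∪ (t : Set E)) ∧
          ∃ hTO : (Algebra.adjoin S (t : Set E)).toSubring ≤ OE.toSubring,
            IsRegularLocalRing (Localization.AtPrime
              (Ideal.comap (Subring.inclusion hTO) (maximalIdeal OE))) ∧
            (∀ σ ∈ H, ∀ x ∈ locAtCentre (Algebra.adjoin S (t : Set E)).toSubring OE,
              σ x ∈ locAtCentre (Algebra.adjoin S (t : Set E)).toSubring OE) ∧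
            x₀ ∈ locAtCentre (Algebra.adjoin S (t : Set E)).toSubring OE)
    (hH : Hironaka1964_local.{u}) (hhead : CossartPiltant2019_descentHead.{u})
    (hP : ∀ (n : ℕ) (k : Type u) [Field k], ∃ (Z : AlgebraicGeometry.Scheme.{u})
      (j : (Literature.AlgebraicGeometry.Motives.projectiveSpace n k).left ⟶ Z),
      AlgebraicGeometry.IsClosedImmersion j ∧ AlgebraicGeometry.IsNoetherian Z ∧ Scheme.IsRegular Z ∧
        Scheme.IsExcellent Z ∧
        ∀ x, (2 : WithBot ℕ∞) ≤ ringKrullDim (Z.presheaf.stalk (j x))) :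
    CossartPiltant2019.{u} :=
  cossartPiltant2019_of_leaves_embedded hloc hCJSE hEqT hEqI hH hhead
    (cossartJannsenSaito2020_of_embedded_of_reembedding hCJSE hP)

/-- **STUB 2 FROM STUB 1 + THE NAMED RESIDUE (universe `0`)** (hand-1 g16): `CossartPiltant2019.{0}` (the type of
`stub_cossartPiltant2019`) from `CossartPiltant2019Local` (CP Thm. 1.5), `CossartJannsenSaito2020Embedded.{0}` (the
TYPE of stub 1), `hEqT`, `hEqI` (not in print), `Hironaka1964_local` (Temkin 2008; idle at characteristic `p`) and
`CossartPiltant2019_descentHead`; principalization, patching, CJS Thm. 1.2 over fields (`cossartJannsenSaito2020_of_embedded`)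
and for excellent surfaces (re-keyed rank-one reduction) are DISCHARGED in the tree.
[cite: CossartPiltant2019, Thm. 1.1, Thm. 1.5, Props. 4.4, 4.6, 4.8, 4.10] [cite: CossartJannsenSaito2020, Thm. 1.2, Thm. 1.4] -/
theorem cossartPiltant2019_of_stub1_of_leaves
    (hloc : CossartPiltant2019Local.{0}) (hCJSE : CossartJannsenSaito2020Embedded.{0})
    (hEqT :
      ∀ (p : ℕ), p.Prime →
      ∀ (S : Type) [CommRing S] [IsDomain S] [IsRegularLocalRing S],
        IsExcellentRing S → ringKrullDim S = 3 → CharP (ResidueField S) p →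
        IsAdicComplete (maximalIdeal S) S →
      ∀ (E : Type) [Field E] [Algebra S E], Function.Injective (algebraMap S E) →
        IsAlgClosed E → Algebra.IsAlgebraic S E →
      ∀ (OE : ValuationSubring E), (∀ s : S, algebraMap S E s ∈ OE) →
        (∀ s ∈ maximalIdeal S, OE.valuation (algebraMap S E s) < 1) →
        (∀ y : OE, ∃ q : S[X], (∃ i, q.coeff i ∉ maximalIdeal S) ∧
          OE.valuation (q.eval₂ (algebraMap S E) y) < 1) →
      Nonempty OE.valuation.RankOne →
      ∀ (M' : Subfield E), (∀ s : S, algebraMap S E s ∈ M') →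
      ∀ (H : Subgroup (E ≃ₐ[S] E)),
        (∀ σ ∈ H, ∀ x ∈ M', σ x ∈ M') →
        (∀ σ ∈ H, ∀ x ∈ M', x ∈ OE → σ x ∈ OE) →
        (∀ σ ∈ H, ∀ x ∈ M', x ∈ OE → OE.valuation (σ x - x) < 1) →
        (∃ ℓ : ℕ, ℓ.Prime ∧ ℓ ≠ p ∧ ∀ σ ∈ H, ∀ x ∈ M', (σ ^ ℓ) x = x) →
        (∀ σ ∈ H, (∃ x ∈ M', σ x ≠ x) →
          ∃ x ∈ M', x ≠ 0 ∧ OE.valuation (σ x - x) = OE.valuation x) →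
        (∃ t : Finset E, (t : Set E) ⊆ M' ∧
          M' ≤ Subfield.closure (Set.range (algebraMap S E) ∪ (t : Set E)) ∧
          ∃ hTO : (Algebra.adjoin S (t : Set E)).toSubring ≤ OE.toSubring,
            IsRegularLocalRing (Localization.AtPrime
              (Ideal.comap (Subring.inclusion hTO) (maximalIdeal OE)))) →
        ∃ t : Finset E, (t : Set E) ⊆ M' ∧
          M' ≤ Subfield.closure (Set.range (algebraMap S E) ∪ (t : Set E)) ∧
          ∃ hTO : (Algebra.adjoin S (t : Set E)).toSubring ≤ OE.toSubring,
            IsRegularLocalRing (Localization.AtPrime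
              (Ideal.comap (Subring.inclusion hTO) (maximalIdeal OE))) ∧
            (∀ σ ∈ H, ∀ x ∈ locAtCentre (Algebra.adjoin S (t : Set E)).toSubring OE,
              σ x ∈ locAtCentre (Algebra.adjoin S (t : Set E)).toSubring OE))
    (hEqI :
      ∀ (p : ℕ), p.Prime →
      ∀ (S : Type) [CommRing S] [IsDomain S] [IsRegularLocalRing S],
        IsExcellentRing S → ringKrullDim S = 3 → CharP (ResidueField S) p →
        IsAdicComplete (maximalIdeal S) S →
      ∀ (E : Type) [Field E] [Algebra S E], Function.Injective (algebraMap S E) →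
        IsAlgClosed E → Algebra.IsAlgebraic S E →
      ∀ (OE : ValuationSubring E), (∀ s : S, algebraMap S E s ∈ OE) →
        (∀ s ∈ maximalIdeal S, OE.valuation (algebraMap S E s) < 1) →
        (∀ y : OE, ∃ q : S[X], (∃ i, q.coeff i ∉ maximalIdeal S) ∧
          OE.valuation (q.eval₂ (algebraMap S E) y) < 1) →
      Nonempty OE.valuation.RankOne →
      ∀ (M' : Subfield E), (∀ s : S, algebraMap S E s ∈ M') →
      ∀ (H : Subgroup (E ≃ₐ[S] E)),
        (∀ σ ∈ H, ∀ x ∈ M', σ x ∈ M') →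
        (∀ σ ∈ H, ∀ x ∈ M', x ∈ OE → σ x ∈ OE) →
        (∀ σ ∈ H, (∃ x ∈ M', σ x ≠ x) →
          ∃ x ∈ M', OE.valuation x = 1 ∧ OE.valuation (σ x - x) = 1) →
      ∀ (x₀ : E), x₀ ∈ M' → x₀ ∈ OE →
        (∃ t : Finset E, (t : Set E) ⊆ M' ∧
          M' ≤ Subfield.closure (Set.range (algebraMap S E) ∪ (t : Set E)) ∧
          ∃ hTO : (Algebra.adjoin S (t : Set E)).toSubring ≤ OE.toSubring,
            IsRegularLocalRing (Localization.AtPrime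
              (Ideal.comap (Subring.inclusion hTO) (maximalIdeal OE)))) →
        ∃ t : Finset E, (t : Set E) ⊆ M' ∧
          M' ≤ Subfield.closure (Set.range (algebraMap S E) ∪ (t : Set E)) ∧
          ∃ hTO : (Algebra.adjoin S (t : Set E)).toSubring ≤ OE.toSubring,
            IsRegularLocalRing (Localization.AtPrime
              (Ideal.comap (Subring.inclusion hTO) (maximalIdeal OE))) ∧
            (∀ σ ∈ H, ∀ x ∈ locAtCentre (Algebra.adjoin S (t : Set E)).toSubring OE,
              σ x ∈ locAtCentre (Algebra.adjoin S (t : Set E)).toSubring OE) ∧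
            x₀ ∈ locAtCentre (Algebra.adjoin S (t : Set E)).toSubring OE)
    (hH : Hironaka1964_local.{0}) (hhead : CossartPiltant2019_descentHead.{0}) :
    CossartPiltant2019.{0} :=
  cossartPiltant2019_of_leaves_embedded hloc hCJSE hEqT hEqI hH hhead
    (cossartJannsenSaito2020_of_embedded hCJSE)

end Summit.ResolutionOfSingularities.ResolutionOfSingularities.Theorems.RadicialJung.CleanModels

end
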